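import Mathlib
import HarnessLib
import Summits.HubbardSuperconductivity.HubbardSuperconductivity.Theorems.KLProgrammeC4aInvariantDefs

/-!
# Route `KLProgramme` — crux C4a: RIGIDITY of the `G = 0` singular configurations under the co-moving flow (C4A-PLAN §10)

Cell `gate-hubbard-kl`, lane hubbard-kl-c4a-1; helper for the engine-flow child `KLRegimeEngineV17F2` (stmt-HubbardSuperconductivity-20437), stub (C).
Central symmetry of the chart (`levelPoint_add_pi`, …C4aInvariantDefs) makes the Cooper / forward / exchange configurations co-move EXACTLY:
the signed sum of chart points carried by a line of such a configuration stays on a level curve of the frame band for all flow times,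
so that line's energy is CONSTANT along the flow — the hypothesis `G(x₀, ·) ≡ 0` of the softness lemmas `abs_iteratedDeriv_le_of_rigid(_on)`
(…C4aTangentialSoftness §4/§5), whence every co-moving derivative landing on such a line is soft.  Umklapp lines (`G ≠ 0`, the C4b corner)
are NOT rigid — that is the per-scale corner logarithm (DECOMP App. C), and only there.

* `levelPoint_add_levelPoint_add_pi` (antipodal chart points cancel), `frameLevel_neg` (the frame band is even), `frameLevel_neg_levelPoint`;
* `frameLevel_cooper_rigid`: `e_K(Φ(0,θ+t) + Φ(0,θ+π+t) − Φ(ρ',ϑ'+t)) = ρ'` for all `t, ϑ'` (the pair bubble's second line at the Cooper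
  configuration); `frameLevel_forward_rigid`: `e_K(Φ(0,θ+t) − Φ(0,θ+t) + Φ(ρ',ϑ'+t)) = ρ'` (zero transfer).

Theorems only; nothing is asserted about the Hubbard model.  References: FST II CPAM 51 (1998) 1133 §3 (the change of variables and its
singular configurations); BGM 2006 §2.4 [cite: BenfattoGiulianiMastropietro2006].
-/

noncomputable section

namespace Summit.HubbardSuperconductivity.HubbardSuperconductivity.Theorems.C4a

set_option linter.dupNamespace false -- summit = problem name (single-conjunct summit), D-0017

open Real Set
open Literature.MathematicalPhysics.QuantumLattice Literature.MathematicalPhysics.QuantumLattice.BandSectorCounting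
open Summit.HubbardSuperconductivity.HubbardSuperconductivity.Theorems.DispersionFlow
open Summit.HubbardSuperconductivity.HubbardSuperconductivity.Theorems.KLRegimeSplit
open Summit.HubbardSuperconductivity.HubbardSuperconductivity.Theorems.PerturbedFermiCurve

/-! ## Rigidity identities

Central symmetry makes the Cooper / forward / exchange configurations co-move EXACTLY: the signed sums of co-moving chart points that a line
of such a configuration carries stay on a level curve for all times, so the line's energy is constant along the flow (and, by
`abs_iteratedDeriv_le_of_rigid(_on)` of `…C4aTangentialSoftness`, SOFT nearby). -/

section Rigid

/-- Antipodal chart points cancel: `Φ(ρ, ϑ) + Φ(ρ, ϑ + π) = 0`. -/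
theorem levelPoint_add_levelPoint_add_pi (μ : ℝ) (K : TrigPolyC4v) (ρ ϑ : ℝ) :
    levelPoint μ K ρ ϑ + levelPoint μ K ρ (ϑ + π) = 0 := by
  rw [levelPoint_add_pi, add_neg_cancel]

/-- The frame band is even: `e_K(−q) = e_K(q)` (the free band and every frame are even). -/
theorem frameLevel_neg (μ : ℝ) (K : TrigPolyC4v) (q : Momentum) : frameLevel μ K (-q) = frameLevel μ K q := by
  simp only [frameLevel, squareDispersion]
  have h1 : ((-q : Momentum) : Fin 2 → ℝ) 0 = -(q 0) := rfl
  have h2 : ((-q : Momentum) : Fin 2 → ℝ) 1 = -(q 1) := rfl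
  have h3 : WithLp.ofLp (-q) = -WithLp.ofLp q := rfl
  rw [h1, h2, h3, Real.cos_neg, Real.cos_neg, TrigPolyC4v.eval_neg]

/-- The negative of a chart point lies on the same level curve: `e_K(−Φ(ρ, ϑ)) = ρ` (band hypotheses at `μ + ρ`). -/
theorem frameLevel_neg_levelPoint {a b : ℝ} (B : BandBounds a b) {K : TrigPolyC4v} {A : ℝ}
    (hA : ∀ p : Momentum, ∀ j ≤ 2, ‖iteratedFDeriv ℝ j (frameShift K) p‖ ≤ A) {μ ρ : ℝ} (hlo : a ≤ μ + ρ - A)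
    (hhi : μ + ρ + A ≤ b) (ϑ : ℝ) : frameLevel μ K (-levelPoint μ K ρ ϑ) = ρ := by
  rw [frameLevel_neg, frameLevel_levelPoint B hA hlo hhi]

/-- **The Cooper configuration is RIGID**: along the co-moving flow, the second line of the pair bubble attached to the external legs
`k = Φ(0, θ + t)` (in) and `−k = Φ(0, θ + π + t)` carries `X(t) = Φ(0, θ+t) + Φ(0, θ+π+t) − Φ(ρ', ϑ'+t) = −Φ(ρ', ϑ'+t)`, whose energy is
the constant `ρ'` — for EVERY inner loop angle `ϑ'` and every `t`. -/
theorem frameLevel_cooper_rigid {a b : ℝ} (B : BandBounds a b) {K : TrigPolyC4v} {A : ℝ}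
    (hA : ∀ p : Momentum, ∀ j ≤ 2, ‖iteratedFDeriv ℝ j (frameShift K) p‖ ≤ A) {μ ρ' : ℝ} (hlo : a ≤ μ + ρ' - A)
    (hhi : μ + ρ' + A ≤ b) (θ ϑ' t : ℝ) :
    frameLevel μ K (levelPoint μ K 0 (θ + t) + levelPoint μ K 0 (θ + π + t) - levelPoint μ K ρ' (ϑ' + t)) = ρ' := by
  rw [show θ + π + t = (θ + t) + π by ring, levelPoint_add_levelPoint_add_pi, zero_sub]
  exact frameLevel_neg_levelPoint B hA hlo hhi (ϑ' + t)

/-- **The forward/exchange configuration is RIGID**: with the external leg `k = Φ(0, θ + t)` entering and leaving a loop line unchanged,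
`X(t) = Φ(0, θ+t) − Φ(0, θ+t) + Φ(ρ', ϑ'+t) = Φ(ρ', ϑ'+t)` has constant energy `ρ'`. -/
theorem frameLevel_forward_rigid {a b : ℝ} (B : BandBounds a b) {K : TrigPolyC4v} {A : ℝ}
    (hA : ∀ p : Momentum, ∀ j ≤ 2, ‖iteratedFDeriv ℝ j (frameShift K) p‖ ≤ A) {μ ρ' : ℝ} (hlo : a ≤ μ + ρ' - A)
    (hhi : μ + ρ' + A ≤ b) (θ ϑ' t : ℝ) :
    frameLevel μ K (levelPoint μ K 0 (θ + t) - levelPoint μ K 0 (θ + t) + levelPoint μ K ρ' (ϑ' + t)) = ρ' := by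
  rw [sub_self, zero_add]
  exact frameLevel_levelPoint B hA hlo hhi (ϑ' + t)

end Rigid

end Summit.HubbardSuperconductivity.HubbardSuperconductivity.Theorems.C4a
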